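import Literature.AlgebraicGeometry.ComplexMultiplication.ShimuraInflationRationalOfRiemann
import Literature.AlgebraicGeometry.HodgeTheory.WeilFamilyReachOfPeriodConstruction
import Literature.AlgebraicGeometry.HodgeTheory.HodgeFiltrationModelsReductionProofs
import Literature.AlgebraicGeometry.HodgeTheory.AbelianVarietyHodgeFullnessRecord
import HarnessLib

/-!
# Shimura's type inflation on `H¹` from Riemann's theorem (fullness of `H¹` on complex abelian varieties)

Family `hodge`, layer `Literature/AlgebraicGeometry/ComplexMultiplication`; KERNEL ONLY (two theorems; no
definition, no new hypothesis minted).  ONE RECORD CONSUMED: Riemann's theorem in the form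
`HodgeTheory.DeligneMilne1982_Thm_6_20_full` ([DeligneMilne1982Tannakian] Thm. 6.20, fullness of `H¹_B`
on complex abelian varieties up to isogeny, restricted to a target carrying a Hodge model; sibling record
file `HodgeTheory/AbelianVarietyHodgeFullnessRecord`).

`ShimuraIsogeny.Shimura1998_Thm3_inflation` — for a realisation `(A, ι, θ)` of a CM type `(K; Φ)` and a
realisation `(A′, ι′, θ′)` of the INDUCED type `(M; Φ^M)` along `k : K → M`, finitely many
`𝓞_K`-equivariant morphisms `p_j : A′ → A` OF ABELIAN VARIETIES with
`⊕_j p_j^* : H¹(A(ℂ); ℚ)^m → H¹(A′(ℂ); ℚ)` bijective — is derived here (`thm3_inflation_of_riemann`) from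
that ONE input.  The corollary `thm3_inflation_of_hodgeFullness` takes instead, byte for byte, the inline
`(1,0)`-clause form `h` of the tree's `HodgeTheory.exists_isIsogeny_map_eq_nsmul_of_hodgeHom_bettiOne`
(`HodgeTheory/AbelianVarietyHodgeHomFullness`), which implies the record by forgetting a clause and a
premise.  No product of abelian varieties, no isogeny `A′ ∼ B^h` (`Shimura1998_Thm3_isogenousPower`), no
uniqueness-up-to-isogeny record (`Shimura1998_Thm2_Cor`) is used.

RELATION TO `ShimuraInflationRationalOfRiemann`.  That file proves, from a record-free inline form of the
same input, the conclusion READ ON `H¹(−; ℚ)` (`thm3_rational_of_riemann`: scheme morphisms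
`p_j : A′.X → A.X` intertwining the rational CM actions `cmAction`).  The present file reuses its linear
algebra and Hodge-type lemmas BY NAME (`exists_cmLinear_sum_bijective`, `bijective_sum_proj_of_nsmul`,
`cmEquivariant_respects_hodgeTypes`, `IsCMTypeRealisation.nonempty_hodgeModel_dim`) and adds the one step
that statement does not carry: the morphisms are morphisms `A′ ⟶ A` of abelian varieties and the
equivariance holds IN `Hom(A′, A)`, `ι′(k a) ∘ p_j = p_j ∘ ι(a)` — the literal conclusion of
`Shimura1998_Thm3_inflation`.

PROOF.  (1) `K` acts on `V = H¹(A(ℂ); ℚ)` and on `V′ = H¹(A′(ℂ); ℚ)` through the rational CM actions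
`BettiUniverse.cmAction θ`, `BettiUniverse.cmAction θ′ ∘ k`; `dim_ℚ V = [K:ℚ]` makes `V` a `K`-line and
`V′ ≅ K^m`, whence `K`-linear `ψ_j : V → V′` with `⊕_j ψ_j : V^m ≅ V′` (`exists_cmLinear_sum_bijective`).
(2) A `K`-equivariant map is a morphism of Hodge structures of weight one
(`cmEquivariant_respects_hodgeTypes`, granted the model-independence of Hodge types, PROVED in the tree as
`HodgeTheory.hodgePQ_independent_of_hodgeModel_holds`), i.e. `HodgeTheory.IsHodgeMorphismOne A′ A ψ_j`;
the premise `Nonempty (HodgeModel A.dim A.X)` of the record is `IsCMTypeRealisation.nonempty_hodgeModel_dim`.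
(3) Fullness gives `u_j : A′ → A`, `k_j ≥ 1`, `u_j^* = k_j ψ_j`; `⊕_j u_j^* = (⊕_j ψ_j) ∘ diag(k_j)` is
bijective (`bijective_sum_proj_of_nsmul`).  (4) `ι′(k a) ∘ u_j = u_j ∘ ι(a)` because both sides agree on
`H¹(A(ℂ); ℚ)` (`K`-linearity of `ψ_j`, `cmAction_eq_pull`) and a homomorphism of complex abelian
varieties is determined by `H¹` (`AbelianVariety.hom_eq_of_bettiCohomology_map_one_eq`, PROVED in
`HodgeTheory/WeilFamilyReachOfPeriodConstruction`).

## References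

* [Shimura1998] G. Shimura, *Abelian Varieties with Complex Multiplication and Modular Functions*
  (Princeton 1998), §6.1 Theorem 2 with Corollary and Remark, §6.2 Theorem 3 with proof (held text
  chunks p0053–p0054), as recorded in `ShimuraIsogeny` (the statement derived here is that record's
  `H¹`-form `Shimura1998_Thm3_inflation`).
* [DeligneMilne1982Tannakian] P. Deligne, J. S. Milne, *Tannakian Categories*, LNM 900 (1982),
  pp. 101–228, §6 Theorem 6.20 (Riemann) (the fullness input, record
  `HodgeTheory/AbelianVarietyHodgeFullnessRecord`).
* [Lange2023AbelianVarietiesComplex] H. Lange, *Abelian Varieties over the Complex Numbers* (2023), §1.1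
  Prop. 1.1.6 (b), eq. (1.2), Cor. 2.1.17 (the same input through complex tori, as recorded inline in
  `HodgeTheory/AbelianVarietyHodgeHomFullness`; hypothesis of the corollary).
* [Deligne1982HodgeCycles] P. Deligne (notes by J. S. Milne), *Hodge cycles on abelian varieties*, LNM 900
  (1982), §4–§5 (`E`-actions on `H¹`, eigen-decomposition, CM types), proof of Thm. 4.8 pp. 48–49.
-/

noncomputable section

open scoped TensorProduct
open NumberField CategoryTheory Module

namespace Literature.AlgebraicGeometry.ComplexMultiplication

open Literature.AlgebraicGeometry.Motives (SchemeOver IsSmoothProjective CMType AbelianVariety bettiCohomology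
  ComplexPoints)
open Literature.AlgebraicGeometry.HodgeTheory (complexBetti IsOfHodgeType)
open Literature.AlgebraicGeometry.HodgeTheory.BettiUniverse (pull cmAction IsInducedOnIntegers)
open Literature.NumberTheory.ComplexMultiplication (inducedCMType)

/-! ## The theorem -/

/-- KERNEL: **Riemann's theorem (`H¹_B` full on abelian varieties up to isogeny; Deligne–Milne 1982
Thm. 6.20, record `HodgeTheory.DeligneMilne1982_Thm_6_20_full`) implies Shimura's type inflation on `H¹`**
(`Shimura1998_Thm3_inflation`). [folklore] -/
theorem thm3_inflation_of_riemann (hR : HodgeTheory.DeligneMilne1982_Thm_6_20_full) :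
    Shimura1998_Thm3_inflation := by
  intro K M _ _ _ _ _ _ k Φ A ι θ A' ι' θ' hA hA'
  -- the rational CM actions on finite-dimensional `H¹(−; ℚ)`
  have hθ : IsInducedOnIntegers θ := hA.isInducedOnIntegers
  have hθ' : IsInducedOnIntegers θ' := hA'.isInducedOnIntegers
  have hV : Module.finrank ℚ (bettiCohomology A.X 1) = Module.finrank ℚ K := by
    rw [HodgeTheory.BettiUniverse.finrank_bettiCohomology_eq hA.1 1, hA.2.1]
  have hV' : Module.finrank ℚ (bettiCohomology A'.X 1) = Module.finrank ℚ M := by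
    rw [HodgeTheory.BettiUniverse.finrank_bettiCohomology_eq hA'.1 1, hA'.2.1]
  haveI : Module.Finite ℚ (bettiCohomology A.X 1) :=
    Module.finite_of_finrank_pos (by rw [hV]; exact Module.finrank_pos)
  haveI : Module.Finite ℚ (bettiCohomology A'.X 1) :=
    Module.finite_of_finrank_pos (by rw [hV']; exact Module.finrank_pos)
  let ρ : K →ₐ[ℚ] Module.End ℚ (bettiCohomology A.X 1) := cmAction θ hθ
  let ρ' : K →ₐ[ℚ] Module.End ℚ (bettiCohomology A'.X 1) := (cmAction θ' hθ').comp k.toRatAlgHom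
  -- (1) `K`-linear coordinates
  obtain ⟨m, ψ, hbij, hequiv⟩ := exists_cmLinear_sum_bijective ρ ρ' hV
  have hequiv' : ∀ (j : Fin m) (a : K) (v : bettiCohomology A.X 1),
      ψ j (cmAction θ hθ a v) = cmAction θ' hθ' (k a) (ψ j v) := fun j a v ↦ by
    simpa [ρ, ρ'] using hequiv j a v
  -- (2) each `ψ_j` is a morphism of rational Hodge structures of weight one
  have hHodge : ∀ j : Fin m, HodgeTheory.IsHodgeMorphismOne A' A (ψ j) := fun j ↦
    cmEquivariant_respects_hodgeTypes k HodgeTheory.hodgePQ_independent_of_hodgeModel_holds hA hA' hθ hθ'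
      (ψ j) (hequiv' j)
  -- (3) fullness: `u_j : A′ → A` with `u_j^* = n_j • ψ_j`
  have hfull := fun j : Fin m ↦ hR A' A (ψ j) hA.nonempty_hodgeModel_dim (hHodge j)
  choose u n hn hu using hfull
  refine ⟨m, u, ?_, ?_⟩
  · exact bijective_sum_proj_of_nsmul ψ (fun j ↦ (bettiCohomology.map (u j).hom.hom.hom 1).hom) hbij n hn
      fun j x ↦ hu j x
  · -- (4) equivariance, checked on `H¹(A(ℂ); ℚ)`
    intro j a
    apply HodgeTheory.AbelianVariety.hom_eq_of_bettiCohomology_map_one_eq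
    have e₁ : (ι' (RingOfIntegers.mapRingHom k a) ≫ u j).hom.hom.hom =
        (ι' (RingOfIntegers.mapRingHom k a)).hom.hom.hom ≫ (u j).hom.hom.hom := rfl
    have e₂ : (u j ≫ ι a).hom.hom.hom = (u j).hom.hom.hom ≫ (ι a).hom.hom.hom := rfl
    rw [e₁, e₂, Motives.bettiCohomology.map_comp, Motives.bettiCohomology.map_comp]
    ext x
    -- the two actions of `a` on `H¹(−; ℚ)` are pull-backs along `ι(a)`, `ι′(k a)`
    have p₁ : (cmAction θ hθ (a : K) : Module.End ℚ (bettiCohomology A.X 1)) = pull (ι a).hom.hom.hom 1 :=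
      cmAction_eq_pull θ hθ (hA.2.2.1 a)
    have p₂ : (cmAction θ' hθ' (k a) : Module.End ℚ (bettiCohomology A'.X 1)) =
        pull (ι' (RingOfIntegers.mapRingHom k a)).hom.hom.hom 1 := by
      have e := cmAction_eq_pull θ' hθ' (hA'.2.2.1 (RingOfIntegers.mapRingHom k a))
      rw [RingOfIntegers.mapRingHom_apply] at e
      exact e
    change (bettiCohomology.map (ι' (RingOfIntegers.mapRingHom k a)).hom.hom.hom 1).hom
        ((bettiCohomology.map (u j).hom.hom.hom 1).hom x) =
      (bettiCohomology.map (u j).hom.hom.hom 1).hom ((bettiCohomology.map (ι a).hom.hom.hom 1).hom x)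
    change pull (ι' (RingOfIntegers.mapRingHom k a)).hom.hom.hom 1 (bettiCohomology.map (u j).hom.hom.hom 1 x) =
      bettiCohomology.map (u j).hom.hom.hom 1 (pull (ι a).hom.hom.hom 1 x)
    rw [← p₁, ← p₂, hu j x, hu j, map_nsmul, hequiv' j a x]

/-- KERNEL, corollary: the same conclusion from the `(1,0)`-clause-only form of fullness — the inline
hypothesis `h` of `HodgeTheory.exists_isIsogeny_map_eq_nsmul_of_hodgeHom_bettiOne`
(`HodgeTheory/AbelianVarietyHodgeHomFullness`, [Lange2023AbelianVarietiesComplex] Prop. 1.1.6 (b),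
eq. (1.2), Cor. 2.1.17 as recorded there), which implies the record by forgetting the `(0,1)` clause.
[folklore] -/
theorem thm3_inflation_of_hodgeFullness
    (hF : ∀ (A B : AbelianVariety ℂ) (ψ : bettiCohomology B.X 1 →ₗ[ℚ] bettiCohomology A.X 1),
      (∀ x : ℂ ⊗[ℚ] bettiCohomology B.X 1,
        IsOfHodgeType B.dim B.X 1 1 0 (Motives.ofRatClassBaseChange (ComplexPoints B.X) 1 x) →
        IsOfHodgeType A.dim A.X 1 1 0
          (Motives.ofRatClassBaseChange (ComplexPoints A.X) 1 (ψ.baseChange ℂ x))) →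
      ∃ (u : A ⟶ B) (k : ℕ), 0 < k ∧ ∀ x, bettiCohomology.map u.hom.hom.hom 1 x = k • ψ x) :
    Shimura1998_Thm3_inflation :=
  thm3_inflation_of_riemann fun A B ψ _ hψ ↦ hF A B ψ hψ.1

end Literature.AlgebraicGeometry.ComplexMultiplication

end
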